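import Summits.HodgeConjecture.HodgeConjecture.Theorems.Ring2AtlasCMSixfoldsNonVacuity
import Summits.HodgeConjecture.HodgeConjecture.Theorems.Ring2AtlasCMSixfoldsNondegenerateNonVacuity
import Summits.HodgeConjecture.HodgeConjecture.Theorems.Ring2AtlasCMSixfoldsDegenerateNonVacuity
import Summits.HodgeConjecture.HodgeConjecture.Theorems.Ring2AtlasCMSevenfoldsNonVacuity
import Summits.HodgeConjecture.HodgeConjecture.Theorems.Ring2AtlasUnitaryProductCellsNonVacuity
import Summits.HodgeConjecture.CorCM.Model.CMAbelianVarietyRealisedHolds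
import Summits.HodgeConjecture.CorCM.SimpleCMPrimeDimensionHodge
import Summits.HodgeConjecture.CorCM.Assembly.CarrierNonVacuity
import HarnessLib

set_option linter.dupNamespace false

/-!
# Ring 2 atlas-2 — the CM rows and cells of the `g = 6, 7` atlas WITHOUT the realisation hypothesis: the five
# typed CM classes are inhabited outright, the open degenerate cell carries a certified exceptional Hodge class,
# and COR-CM's unconditional closer of the simple CM sevenfold row is used by name

HONEST FRAMING (cell `pub-hodge-ring2`, verbatim): «research route conditional on HC_CM; not a corollary;
Q11.4-sentence-2 already refuted in dim ≥ 3».  `HC_CM` = `Theses.RankFourFaces.CMAbelianHodge` (item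
stmt-HodgeConjecture-3052) is an explicit ARGUMENT of the one theorem below that uses it (§1,
`…_cmLocus_nonempty_of_cmAbelianHodge'`) — never an axiom, never «known».  No number and no status word of the
atlas (AV-HODGE-ATLAS.md) moves; no Hodge class is computed here; every input is a tree theorem.

WHAT CHANGED IN THE TREE (cell COR-CM = `pub-hodgecm2`, 2026-08-21, out of this cell; recorded BY NAME):

* `CorCM.cmAbelianVarietyRealised_holds : PicardCM.CMAbelianVarietyRealised`
  (`CorCM/Model/CMAbelianVarietyRealisedHolds`): the realisation record `(h₃)` — for every CM field `K` and CM
  type `Φ` an abelian variety `A/ℂ` with `ι : 𝓞_K → End A` realising `(K; Φ)` on `H¹` — is a THEOREM (Shimura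
  1998 §6.2 Thm. 3 on `ℂ^Φ/D(𝓞_K)`, Thm. 4, with Lefschetz's theorem, Chow and GAGA in the kernel), axioms standard.
  The six atlas-2 non-vacuity modules (generations 45–50: `Ring2AtlasCMSixfoldsNonVacuity`,
  `…DegenerateNonVacuity`, `Ring2AtlasCMSevenfoldsCyclotomic43` / `…SevenfoldsNonVacuity`,
  `…NondegenerateNonVacuity`, `Ring2AtlasUnitaryProductCellsNonVacuity`) carried `(h₃)` as an explicit argument;
  §1 applies them to the theorem, so each typed CM class is inhabited with NO hypothesis (the row `g = 6` form is
  COR-CM's `exists_simple_cm_sixfold`, reused by name).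
* `CorCM.hodgeSimpleCMSevenfold_holds : Ring2.Atlas.HodgeSimpleCMSevenfold` (`CorCM/SimpleCMPrimeDimensionHodge`,
  p251209): the atlas row `g = 7`, simple, CM-type is CLOSED UNCONDITIONALLY — from the Literature theorem
  `Pohlmann1968.isDivisorGenerated_powSucc_of_isSimple_of_isOfCMType_of_prime` (the CM clause of Tankeev–Ribet:
  `X` simple, of CM type, of prime dimension ⟹ every power divisor-generated; Yanai 1985, Moonen–Zarhin 1999
  (2.7)), with neither `HC_CM` nor the named fact `TankeevRibet1983_…` entering.  §3 USES it (a restatement in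
  this seat's universe `Theorems/Ring2*`, permitted by cell LEAD ruling L54.2 (c), is refused by the gate rule
  `dedup.landed`; the census keeps its by-name record): there is a simple CM abelian sevenfold satisfying the
  Hodge conjecture, no hypothesis.

WHAT IS NEW HERE (§2): the OPEN cell `HodgeDegenerateCMSixfold = HCOnClass (IsSimpleCMSixfold ∧
HasBalancedQuadraticEndomorphism)` has a member carrying a rational `(3,3)`-class OUTSIDE the span `D³ ⊗ ℂ` of
triple products of divisor classes — a realisation of the primitive degenerate type `(ℚ(ζ₂₁); Φ₂₁)` of the tree's
`Pohlmann1968.DegenerateCMTypeCyclotomic21` (its exceptional class: `Cyclotomic.exists_exceptional_Φ₂₁`, Pohlmann's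
criterion / van Geemen 4.5–4.7; its membership in the TYPED cell: generation 46's
`Cyclotomic21.hasBalancedQuadraticEndomorphism_Φ₂₁`, the endomorphism `ι(2ζ₂₁⁷ + 1)` of square `-3` acting on
`H^{1,0}` with eigenvalue `i√3` of multiplicity `3`).  Hence the cell is NOT decided by Lefschetz `(1,1)` and
products (`not_forall_mem_degenerateCMSixfoldCell_hodgeClass_mem_divisorClassesSpan`): its status word OPEN is
substantiated in the kernel, at a named member.  (COR-CM's `exists_simple_cm_sixfold_exceptional` records the same
variety as an instance of the open content of `HC_CM`; the typed-cell membership is this seat's.)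

WHAT THIS IS NOT: no instance of the Hodge conjecture is proved by this seat (§3 is COR-CM's theorem, a KNOWN case
— count once, theirs); the cells `HodgeDegenerateCMSixfold`, `HodgeNondegenerateCMSixfold` (known in print, not
in the tree), the row `HodgeSimpleCMSixfold` and the three unitary-product cells keep their status words; the
two `g = 6` unitary-product cells are still not kernel-inhabited.

## References

* [Shimura1998] G. Shimura, *Abelian Varieties with Complex Multiplication and Modular Functions* (1998), §6.2
  Thms. 3–4 (pp. 41–46), §8.2 Prop. 26 (p. 61), §8.4 Ex. (1) (p. 64), §5.2 (pp. 38–39).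
* [Pohlmann1968] H. Pohlmann, *Algebraic cycles on abelian varieties of complex multiplication type*, Ann. of
  Math. 88 (1968), Thm. 1 and §3.
* [vanGeemen1994HodgeAV] B. van Geemen, *An introduction to the Hodge conjecture for abelian varieties*, LNM
  1594 (1994), Thm. 4.5, 4.7, Def. 4.9.
* [MoonenZarhin1999LowDim] B. Moonen, Yu. Zarhin, Math. Ann. 315 (1999), §2 Thm. (2.7), §5.
* [Gordon1999HodgeAVSurvey] B. B. Gordon, *A survey of the Hodge conjecture for abelian varieties* (1999),
  Thm. 6.3, Corollary and Remark; 5.13 (ii); 9.2.2.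
* [Yanai1985] H. Yanai, Nagoya Math. J. 97 (1985), §4 Theorem.
* [Deligne2000] P. Deligne, *The Hodge conjecture* (Clay, 2000), §1.
* [Milne1999] J. S. Milne, Compositio Math. 117 (1999), §2 p. 54, §7.
-/

noncomputable section

open CategoryTheory NumberField

namespace Summit.HodgeConjecture.HodgeConjecture.Ring2.Atlas

open Literature.AlgebraicGeometry Literature.AlgebraicGeometry.Motives
open Literature.AlgebraicGeometry.HodgeTheory
open Literature.AlgebraicGeometry.ComplexMultiplication (IsCMTypeRealisation)
open Literature.NumberTheory.ComplexMultiplication (isOfCMType_of_isCMTypeRealisation)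
open Literature.NumberTheory.Automorphic (PicardCM.CMAbelianVarietyRealised)
open Literature.AlgebraicGeometry.Milne1999 (IsOfCMType)
open Literature.AlgebraicGeometry.Pohlmann1968.Cyclotomic (Φ₂₁ isSimple_Φ₂₁ dim_eq_six exists_exceptional_Φ₂₁)
open Literature.Barriers.HodgeConjecture (divisorClassesSpan)
open Summit.HodgeConjecture.CorCM (cmAbelianVarietyRealised_holds)

/-! ## §1 `(h₃)` is a tree theorem: the five typed CM classes of the `g = 6, 7` atlas are inhabited outright -/

/- Row `g = 6`, simple, CM-type: its class `IsSimpleCMSixfold` is inhabited with no hypothesis — this is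
COR-CM's `CorCM.exists_simple_cm_sixfold` (generation 45's `exists_isSimpleCMSixfold_of_cmAbelianVarietyRealised`
applied to `cmAbelianVarietyRealised_holds`, landed there first); reused by name, not restated (gate rule
`dedup.landed`). -/

/-- The class of the row target `HodgeSimpleCMSixfold = HCOnClass IsSimpleCMSixfold` is nonempty, outright.
[cite: Shimura1998, §6.2 Thm. 3, pp. 41–42] -/
theorem hodgeSimpleCMSixfold_class_nonempty' : {A : AbelianVariety ℂ | IsSimpleCMSixfold A}.Nonempty :=
  CorCM.exists_simple_cm_sixfold

/-- **Cell `g = 6`, simple, CM-type, NONDEGENERATE (known in print): its class is inhabited — no hypothesis**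
(generation 49: every realisation of `(ℚ(ζ₁₃); {φ₁,…,φ₆})` has `End⁰ = ℚ(ζ₁₃)`, which contains no element of
negative rational square). [cite: Shimura1998, §5.1 Props. 3, 4, 6; §6.2 Thm. 3] [cite: Milne1999, §2 p. 54] -/
theorem hodgeNondegenerateCMSixfold_class_nonempty' :
    {A : AbelianVariety ℂ | IsSimpleCMSixfold A ∧ ¬ HasBalancedQuadraticEndomorphism A}.Nonempty :=
  hodgeNondegenerateCMSixfold_class_nonempty cmAbelianVarietyRealised_holds

/-- **Cell `g = 6`, simple, CM-type, DEGENERATE (OPEN): its class is inhabited — no hypothesis** (generation 46: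
every realisation of `(ℚ(ζ₂₁); Φ₂₁)`, with `ι(2ζ₂₁⁷ + 1)` of square `-3` acting `(3,3)`).
[cite: Shimura1998, §5.2 pp. 38–39; §6.2 Thm. 3] [cite: Pohlmann1968, §3] -/
theorem hodgeDegenerateCMSixfold_class_nonempty' :
    {A : AbelianVariety ℂ | IsSimpleCMSixfold A ∧ HasBalancedQuadraticEndomorphism A}.Nonempty :=
  hodgeDegenerateCMSixfold_class_nonempty cmAbelianVarietyRealised_holds

/-- **Row `g = 7`, simple, CM-type: its class is inhabited — no hypothesis** (generation 48: every realisation of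
the primitive type of the cyclic CM field of degree `14` inside `ℚ(ζ₄₃)`).
[cite: Shimura1998, §8.2 Prop. 26, p. 61; §8.4; §6.2 Thm. 3] -/
theorem exists_isSimpleCMSevenfold : ∃ A : AbelianVariety ℂ, A.dim = 7 ∧ A.IsSimple ∧ IsOfCMType A :=
  exists_isSimpleCMSevenfold_of_cmAbelianVarietyRealised cmAbelianVarietyRealised_holds

/-- The class of the row target `HodgeSimpleCMSevenfold` is nonempty, outright.
[cite: Shimura1998, §6.2 Thm. 3, pp. 41–42] -/
theorem hodgeSimpleCMSevenfold_class_nonempty' :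
    {A : AbelianVariety ℂ | A.dim = 7 ∧ A.IsSimple ∧ IsOfCMType A}.Nonempty :=
  exists_isSimpleCMSevenfold

/-- **Cell `g = 7`, powers of `E × Y₆` with multiplication by the same `k` (OPEN): its typed class is inhabited —
no hypothesis** (generation 50's witness with `d = 3`: `E` a realisation of `(ℚ(ζ₃); {1})` with `φ = ι(2ζ₃ + 1)`,
`Y` the simple CM sixfold `(ℚ(ζ₂₁); Φ₂₁)` with `ψ = ι(2ζ₂₁⁷ + 1)`; a witness on the cell's CM locus, not in its
intended type-IV class). [cite: Shimura1998, §6.2 Thm. 3, pp. 41–42] [cite: MoonenZarhin1999LowDim, §3 (3.8) and §5] -/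
theorem hodgePowersOfCMEllipticTimesUnitarySixfold_class_nonempty' :
    ∃ (E Y : AbelianVariety ℂ) (φ : E ⟶ E) (ψ : Y ⟶ Y) (d : ℕ), 0 < d ∧ E.dim = 1 ∧ Y.dim = 6 ∧ Y.IsSimple ∧
      φ ≫ φ = -(d • 𝟙 E) ∧ ψ ≫ ψ = -(d • 𝟙 Y) ∧ IsOfCMType E ∧ IsOfCMType Y :=
  hodgePowersOfCMEllipticTimesUnitarySixfold_class_nonempty cmAbelianVarietyRealised_holds

/-- **The `g = 7` unitary-product cell, applied to the witness — no realisation hypothesis**: any proof of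
`HodgePowersOfCMEllipticTimesUnitarySixfold` yields a CM abelian sevenfold all of whose powers satisfy the Hodge
conjecture. [cite: Deligne2000, §1] [cite: Milne1999, §2 p. 54] -/
theorem hodgePowersOfCMEllipticTimesUnitarySixfold.exists_cmSevenfold_powers'
    (h : HodgePowersOfCMEllipticTimesUnitarySixfold) :
    ∃ X : AbelianVariety ℂ, X.dim = 7 ∧ IsOfCMType X ∧
      ∀ N : ℕ, HodgeConjectureFor (X.powSucc N).dim (X.powSucc N).X :=
  hodgePowersOfCMEllipticTimesUnitarySixfold.exists_cmSevenfold_powers h cmAbelianVarietyRealised_holds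

/-- **The CM locus of the `g = 7` unitary-product cell is nonempty outright, and on it the cell's conclusion holds
given `HC_CM`** (`HC_CM` an explicit argument; the only use of it in this file).
[cite: Milne1999, §2 p. 54 and §7 (H)] [cite: Shimura1998, §6.2 Thm. 3, pp. 41–42] -/
theorem hodgePowersOfCMEllipticTimesUnitarySixfold_cmLocus_nonempty_of_cmAbelianHodge'
    (hCM : Theses.RankFourFaces.CMAbelianHodge) :
    ∃ (E Y : AbelianVariety ℂ) (φ : E ⟶ E) (ψ : Y ⟶ Y) (d : ℕ), 0 < d ∧ E.dim = 1 ∧ Y.dim = 6 ∧ Y.IsSimple ∧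
      φ ≫ φ = -(d • 𝟙 E) ∧ ψ ≫ ψ = -(d • 𝟙 Y) ∧ IsOfCMType Y ∧
      ∀ N : ℕ, HodgeConjectureFor ((E.prod Y).powSucc N).dim ((E.prod Y).powSucc N).X :=
  hodgePowersOfCMEllipticTimesUnitarySixfold_cmLocus_nonempty_of_cmAbelianHodge cmAbelianVarietyRealised_holds hCM

/-! ## §2 The open degenerate cell has a member with an EXCEPTIONAL Hodge class (kernel instance of its open content) -/

/-- **A member of the OPEN cell `HodgeDegenerateCMSixfold` carrying a rational `(3,3)`-class outside `D³ ⊗ ℂ` —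
no hypothesis.**  Any realisation `A` of the primitive degenerate CM type `(ℚ(ζ₂₁); Φ₂₁)` (which exists:
`CorCM.cmAbelianVarietyRealised_holds`) is a simple CM sixfold (`dim_eq_six`, `isSimple_Φ₂₁`,
`isOfCMType_of_isCMTypeRealisation`) with a balanced quadratic endomorphism `ι(2ζ₂₁⁷ + 1)`, square `-3`,
multiplicity `3` on `H^{1,0}` (`Cyclotomic21.hasBalancedQuadraticEndomorphism_Φ₂₁`) — so `A` lies in the TYPED
class of the cell — and carries a rational class of Hodge type `(3,3)` in `H⁶(A(ℂ); ℂ)` outside the span of triple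
products of divisor classes (`Cyclotomic.exists_exceptional_Φ₂₁`: Pohlmann's criterion for the Weil classes of
`(A, ℚ(√-3))`). [cite: Pohlmann1968, Thm. 1 and §3] [cite: vanGeemen1994HodgeAV, Thm. 4.5 and 4.7]
[cite: Shimura1998, §5.2 pp. 38–39; §6.2 Theorem 3; §8.2 Prop. 26] -/
theorem exists_mem_degenerateCMSixfoldCell_exceptionalHodgeClass :
    ∃ A : AbelianVariety ℂ, (IsSimpleCMSixfold A ∧ HasBalancedQuadraticEndomorphism A) ∧
      ∃ c : complexBetti A.X (2 * 3), IsRationalClass c ∧ IsOfHodgeType A.dim A.X (2 * 3) 3 3 c ∧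
        c ∉ divisorClassesSpan A.X A.dim 3 := by
  haveI : IsCyclotomicExtension {21} ℚ (CyclotomicField 21 ℚ) := CyclotomicField.isCyclotomicExtension 21 ℚ
  haveI : NumberField (CyclotomicField 21 ℚ) := IsCyclotomicExtension.numberField {21} ℚ _
  haveI : IsCMField (CyclotomicField 21 ℚ) :=
    IsCyclotomicExtension.Rat.isCMField (CyclotomicField 21 ℚ) (S := ({21} : Set ℕ)) ⟨21, rfl, by norm_num⟩
  obtain ⟨A, ι, θ, hA⟩ := cmAbelianVarietyRealised_holds (CyclotomicField 21 ℚ) (Φ₂₁ (CyclotomicField 21 ℚ))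
  have hA' : IsCMTypeRealisation (Φ₂₁ (CyclotomicField 21 ℚ)) A ι θ := hA
  have h6 : A.dim = 6 := dim_eq_six hA'
  refine ⟨A, ⟨⟨h6, isSimple_Φ₂₁ hA', isOfCMType_of_isCMTypeRealisation hA'⟩,
    Cyclotomic21.hasBalancedQuadraticEndomorphism_Φ₂₁ hA'⟩, ?_⟩
  rw [h6]
  exact exists_exceptional_Φ₂₁ hA'

/-- **Hence the open degenerate cell is NOT decided by Lefschetz `(1,1)` and products**: it is false that every
rational `(3,3)`-class on every member of its typed class is a combination of triple products of divisor classes.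
(The cell asserts such classes are ALGEBRAIC; that is its open content, instantiated at a named member.)
[cite: Pohlmann1968, Thm. 1 and §3] [cite: vanGeemen1994HodgeAV, Thm. 4.5 and 4.7] -/
theorem not_forall_mem_degenerateCMSixfoldCell_hodgeClass_mem_divisorClassesSpan :
    ¬ ∀ A : AbelianVariety ℂ, IsSimpleCMSixfold A ∧ HasBalancedQuadraticEndomorphism A →
      ∀ c : complexBetti A.X (2 * 3), IsRationalClass c → IsOfHodgeType A.dim A.X (2 * 3) 3 3 c →
        c ∈ divisorClassesSpan A.X A.dim 3 := by
  intro h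
  obtain ⟨A, hA, c, hcQ, hcH, hcD⟩ := exists_mem_degenerateCMSixfoldCell_exceptionalHodgeClass
  exact hcD (h A hA c hcQ hcH)

/-- The same member witnesses that the ROW `g = 6`, simple, CM-type has exceptional Hodge classes in degree `6`
(codimension `3`), and that they occur in its DEGENERATE cell. [cite: Pohlmann1968, Thm. 1 and §3]
[cite: MoonenZarhin1999LowDim, §5] -/
theorem exists_isSimpleCMSixfold_exceptionalHodgeClass :
    ∃ A : AbelianVariety ℂ, IsSimpleCMSixfold A ∧ HasBalancedQuadraticEndomorphism A ∧
      ∃ c : complexBetti A.X (2 * 3), IsRationalClass c ∧ IsOfHodgeType A.dim A.X (2 * 3) 3 3 c ∧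
        c ∉ divisorClassesSpan A.X A.dim 3 := by
  obtain ⟨A, ⟨h₁, h₂⟩, h₃⟩ := exists_mem_degenerateCMSixfoldCell_exceptionalHodgeClass
  exact ⟨A, h₁, h₂, h₃⟩

/-! ## §3 The row `g = 7`, simple, CM-type is CLOSED UNCONDITIONALLY — COR-CM's theorem, used by name -/

/- `HodgeSimpleCMSevenfold` holds with no `HC_CM` and no named fact: `CorCM.hodgeSimpleCMSevenfold_holds` (p251209:
the CM clause of Tankeev–Ribet as the Literature theorem
`Pohlmann1968.isDivisorGenerated_powSucc_of_isSimple_of_isOfCMType_of_prime`, with `7` prime) — a KNOWN case of the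
Hodge conjecture, newly kernel-checked there, counted once in COR-CM.  A restatement in this seat's universe
`Theorems/Ring2*` (LEAD ruling L54.2 (c) «may restate the closer in a `Ring2*` file») is REFUSED by the gate rule
`dedup.landed` (dry run, generation 51); the census keeps its by-name out-of-scope record, and this file USES the
closer instead. -/

/-- In particular there is a simple CM abelian SEVENFOLD all of whose Hodge classes are algebraic — a tree
theorem with no hypothesis (row closer applied to the row's witness).
[cite: Gordon1999HodgeAVSurvey, Thm. 6.3, Corollary and Remark] [cite: Deligne2000, §1] -/
theorem exists_isSimpleCMSevenfold_hodgeConjectureFor :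
    ∃ A : AbelianVariety ℂ, A.dim = 7 ∧ A.IsSimple ∧ IsOfCMType A ∧ HodgeConjectureFor A.dim A.X := by
  obtain ⟨A, hA⟩ := exists_isSimpleCMSevenfold
  exact ⟨A, hA.1, hA.2.1, hA.2.2, CorCM.hodgeSimpleCMSevenfold_holds A hA⟩

end Summit.HodgeConjecture.HodgeConjecture.Ring2.Atlas

end
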